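import Summits.AtomisticToContinuum.HydrodynamicLimit.Theorems.OneFlightGossipEngineEquilibriumClampedCollisionalWindowLDStubMeasurability

/-!
# A.e.-measurability of the number of over-budget particles under the Gibbs law
(crux `EquilibriumClampedCollisionalWindowLD`, stmt-AtomisticToContinuum-13733; line `coarse-coin-entropy-chain`;
stub `activityOverflow_overflowCount_aemeasurable`, the measurability conjunct of S3 `stub_activityOverflowLD`)

Support file (`--supports stmt-AtomisticToContinuum-13733`) in the vocabulary of
`Theorems/OneFlightGossipEngineEquilibriumClampedCollisionalWindowLDDefs` (`Flow`, `Phase`, `gibbs`, `window`, `runAct`,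
`overflowCount`), on top of `…WindowLDStubMeasurability` (`measurable_indicator_runAct_window`,
`aemeasurable_of_measurable_indicator_good`, `gibbs_compl_good`). No new definitions.

* `measurable_indicator_overflowCount`: the number of over-budget particles
  `overflowCount σ τ V Φ z = #{i : V < act_i(z)}`, cast to `ℝ` and extended by `0` off the good set, is measurable in
  the datum: on the good set it is the finite sum `Σ_i 1{V < 1_good · act_i}` of measurable indicators
  (`measurable_indicator_runAct_window`), and the good set is measurable.
* `activityOverflow_overflowCount_aemeasurable` (registered signature verbatim): hence it is a.e.-measurable under
  the Gibbs law, which is carried by the good set (`gibbs_compl_good`).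

Hypothesis `0 < σ < 1/2` throughout (hard-sphere regularity of the torus geometry at diameter `ε_N ≤ σ`).
-/

noncomputable section

open MeasureTheory ProbabilityTheory Set Filter
open scoped ENNReal BigOperators
open Literature.Analysis.FluidPDE Literature.MathematicalPhysics.KineticTheory
open Literature.Analysis.FunctionSpaces (Torus.partialDeriv Torus.IsSmooth)

namespace Summit.AtomisticToContinuum.HydrodynamicLimit.Theorems.ClampedTransferCoin

/-- On the good set, the (real-cast) number of over-budget particles is the finite sum over the particles of the
indicators `1{V < 1_good · act_i}` of the activities extended by `0` off the good set. -/
theorem overflowCount_eq_sum_ite_indicator {σ : ℝ} (τ V : ℝ) {N : ℕ} (Φ : Flow σ N) {z : Phase N}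
    (hz : z ∈ Φ.good) :
    (overflowCount σ τ V Φ z : ℝ) =
      ∑ i, if V < Φ.good.indicator (runAct σ τ Φ (window τ N) i) z then (1 : ℝ) else 0 := by
  simp only [overflowCount, Set.indicator_of_mem hz, Finset.sum_boole]

/-- **The number of over-budget particles is measurable in the datum** (cast to `ℝ`, extended by `0` off the good
set): a finite sum of indicators of the measurable events `{V < 1_good · act_i}`, times the indicator of the
(measurable) good set. -/
theorem measurable_indicator_overflowCount {σ : ℝ} (hσ : 0 < σ) (hσ2 : σ < 1 / 2) (τ V : ℝ) {N : ℕ}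
    (Φ : Flow σ N) : Measurable (Φ.good.indicator fun z => (overflowCount σ τ V Φ z : ℝ)) := by
  have heq : (Φ.good.indicator fun z => (overflowCount σ τ V Φ z : ℝ)) =
      Φ.good.indicator fun z =>
        ∑ i, if V < Φ.good.indicator (runAct σ τ Φ (window τ N) i) z then (1 : ℝ) else 0 :=
    Set.indicator_congr fun z hz => overflowCount_eq_sum_ite_indicator τ V Φ hz
  rw [heq]
  refine Measurable.indicator (Finset.measurable_sum _ fun i _ => ?_) Φ.measurableSet_good
  exact Measurable.ite (measurableSet_lt measurable_const (measurable_indicator_runAct_window hσ hσ2 τ Φ i))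
    measurable_const measurable_const

/-- **S3 · measurability conjunct** (registered stub of the line `coarse-coin-entropy-chain`): under the Gibbs
law, for `0 < σ < 1/2`, the number of over-budget particles `#{i : act_i > V}` (cast to `ℝ`) is a.e.-measurable in
the datum — it is measurable after extension by `0` off the good set, and the Gibbs law is carried by the good set. -/
theorem activityOverflow_overflowCount_aemeasurable :
    ∀ {σ : ℝ}, 0 < σ → σ < 1 / 2 → ∀ (τ V a₀ θ₀ : ℝ) (u₀ : V3) (N : ℕ) (Φ : Flow σ N),
      AEMeasurable (fun z => (overflowCount σ τ V Φ z : ℝ)) (gibbs σ a₀ θ₀ u₀ N Φ) :=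
  fun {σ} hσ hσ2 τ V a₀ θ₀ u₀ N Φ =>
    aemeasurable_of_measurable_indicator_good Φ (measurable_indicator_overflowCount hσ hσ2 τ V Φ)
      (gibbs_compl_good σ a₀ θ₀ u₀ N Φ)

end Summit.AtomisticToContinuum.HydrodynamicLimit.Theorems.ClampedTransferCoin

end
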